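import Summits.CriticalPhenomena.CardyFormulaZ2.Theorems.CardyIKTransportIKLinearTransportQuenchedAssemblyDefs
import Summits.CriticalPhenomena.CardyFormulaZ2.Theorems.CardyIKTransportIKMixedBoxCrossingQuenchedGlueStep
import Summits.CriticalPhenomena.CardyFormulaZ2.Theorems.CardyIKTransportIKMixedBoxCrossingQuenchedBottomRow
import Summits.CriticalPhenomena.CardyFormulaZ2.Theorems.CardyIKTransportIKMixedBoxCrossingQuenchedHarris7

/-!
# Stub `stub_longCrossOfHarris` (line `pinned-diagram-exchange` v29, crux `CardyIKTransport.IKLinearTransport`,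
# stmt-CriticalPhenomena-5076)

Support file (`--supports stmt-CriticalPhenomena-5076`): the LADDER assembly
`LongCrossOfHarris : HorizontalClause → ApproxHarrisFam → LRAll` of skeleton v29
(`…IKLinearTransportQuenchedAssemblyDefs`).  From the aspect-`2` horizontal clause (black left–right crossings of
`2m × m` boxes with probability `≥ c_H`, every column pattern `S`, every `m ≥ 1`) and approximate Harris for families
of box events (`ApproxHarrisFam`), left–right crossings of every `w × h` box with `n ≤ w ≤ k n`, `n ≤ h`, `n ≥ 1`
have probability `≥ c_k > 0`, uniformly in the pattern and the position.  Theorems only (no new vocabulary).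

Proof.
* THE LADDER (§1, deterministic planar topology, `ladder`): black LR crossings of the `k + 1` boxes
  `[a + jh, a + jh + 2h) × [b, b+h)`, `j ≤ k`, and black BT crossings of the `k` overlap squares
  `[a + (j+1)h, a + (j+2)h) × [b, b+h)`, `j < k`, glue to a black LR crossing of `[a, a + (k+2)h) × [b, b+h)`:
  induction on `j`, each step being the sister crux's landed planar `glueStep` (`d = (j+1)h`, `w₁ = (j+2)h`,
  `w₂ = 2h`, overlap width `h`).  As ONE family `Fin (k + 1 + k) → BoxSpec` (`Fin.append` of the LR boxes and the BT
  squares) this reads `⋂ᵢ boxEvent ⊆ {LR of the (k+2)h × h box}` (`iInter_ladder_subset`); every box of the family is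
  at least `h × h` and has annealed probability `≥ min c_H c_V` (`ladder_family`: the horizontal clause at `m = h`, and
  the landed all-aspect vertical clause `verticalClause_aspect 1` for the `h × h` squares).
* PROBABILITY (§2): fix `k`, put `c = min c_H c_V`, `K = k + 1 + k`, `η = c^K / 2`, and let `n₀ = n₀(K, η)` be the scale
  of `ApproxHarrisFam`.  For `n ≥ n₀` (so `h ≥ n ≥ n₀`): `μ(⋂) ≥ ∏ − η ≥ c^K − c^K/2`, `⋂ ⊆ LR((k+2)h × h)`, and
  `P[LR((k+2)h × h)] ≤ P[LR(w × h)]` because `1 ≤ w ≤ k n ≤ (k+2) h` (`stub_monotone`, antitone in the width).  For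
  `n < n₀`: `w ≤ k n ≤ k n₀` and the explicit floor `bottomRowFloor` gives `P[LR(w × h)] ≥ (1/2)^w ≥ (1/2)^{k n₀}`.
  So `c_k = min (c^K/2) ((1/2)^{k n₀})` works; `(νmix S)(lrCross) = pLR` by `nuMix_real_lrCross`.
-/

noncomputable section

namespace Summit.CriticalPhenomena.CardyFormulaZ2.Theorems.IKLinearTransport.PinnedDiagramExchange.QuenchedAssembly

open scoped Classical BigOperators
open MeasureTheory Set
open Summit.CriticalPhenomena.CardyFormulaZ2.Theorems.IKLinearTransport.PinnedDiagramExchange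
open Summit.CriticalPhenomena.CardyFormulaZ2.Cruxes.IKMixedBoxCrossing.QuenchedChainFKG
  (ApproxHarrisFam BoxSpec boxEvent boxProb boxProb_lr boxProb_tb glueStep bottomRowFloor)
open Summit.CriticalPhenomena.CardyFormulaZ2.Cruxes.IKMixedBoxCrossing.QuenchedChainFKG.Harris7
  (boxEvent_lr boxEvent_tb)
open Summit.CriticalPhenomena.CardyFormulaZ2.Cruxes.IKMixedBoxCrossing.PairedMirrorExploration
  (pLR pTB stub_monotone)
open Summit.CriticalPhenomena.CardyFormulaZ2.Cruxes.IKMixedBoxCrossing.DefectClosureExploration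
  (nuMix_real_lrCross)
open Summit.CriticalPhenomena.CardyFormulaZ2.Cruxes.IKMixedBoxCrossing.Split (HorizontalClause horizontalClause_iff)
open Summit.CriticalPhenomena.CardyFormulaZ2.Theorems.IKLinearTransport.PinnedDiagramExchange.FarRSWAllAspects
  (verticalClause_aspect)
open Literature.Probability.Percolation Literature.Probability.LatticeModels

namespace LongCross

/-! ## §1 The ladder: deterministic gluing and the box family -/

/-- THE LADDER, pointwise: black LR crossings of the boxes `[a + ih, a + ih + 2h) × [b, b+h)`, `i ≤ j`, and
black BT crossings of the overlap squares `[a + ih + h, a + ih + 2h) × [b, b+h)`, `i < j`, give a black LR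
crossing of `[a, a + jh + 2h) × [b, b+h)` — by induction on `j`, each step the planar `glueStep`. [folklore] -/
theorem ladder (x : Obs) (a b : ℤ) {h : ℕ} (hh : 1 ≤ h) : ∀ j : ℕ,
    (∀ i ≤ j, x ∈ lrCross (a + ((i * h : ℕ) : ℤ)) b (2 * h) h) →
    (∀ i < j, x ∈ tbCross (a + ((i * h + h : ℕ) : ℤ)) b h h) →
    x ∈ lrCross a b (j * h + 2 * h) h
  | 0, hL, _ => by simpa using hL 0 le_rfl
  | j + 1, hL, hT => by
    have ih := ladder x a b hh j (fun i hi => hL i (by omega)) (fun i hi => hT i (by omega))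
    have h2 := hL (j + 1) le_rfl
    rw [add_one_mul j h] at h2
    have h3 : x ∈ tbCross (a + ((j * h + h : ℕ) : ℤ)) b (j * h + 2 * h - (j * h + h)) h := by
      rw [show j * h + 2 * h - (j * h + h) = h by omega]
      exact hT j (lt_add_one j)
    rw [add_one_mul j h]
    exact glueStep x a b (j * h + h) (j * h + 2 * h) (2 * h) h (by omega) (by omega) ih h2 h3

/-- THE LADDER AS ONE FAMILY OF BOX EVENTS: the intersection of the `k + 1 + k` box events (LR of the `2h × h`
boxes at shifts `ih`, `i ≤ k`; BT of the `h × h` overlap squares at shifts `ih + h`, `i < k`) is contained in the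
black LR crossing event of the `(kh + 2h) × h` box at `(a, b)`. [folklore] -/
theorem iInter_ladder_subset (S : Set ℤ) (a b : ℤ) {h : ℕ} (hh : 1 ≤ h) (k : ℕ) :
    (⋂ i, boxEvent S (Fin.append
        (fun i : Fin (k + 1) => (⟨true, a + (((i : ℕ) * h : ℕ) : ℤ), b, 2 * h, h⟩ : BoxSpec))
        (fun i : Fin k => (⟨false, a + (((i : ℕ) * h + h : ℕ) : ℤ), b, h, h⟩ : BoxSpec)) i)) ⊆
      obs S ⁻¹' lrCross a b (k * h + 2 * h) h := by
  intro ω hω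
  have hω' := Set.mem_iInter.1 hω
  refine ladder (obs S ω) a b hh k (fun i hi => ?_) (fun i hi => ?_)
  · have := hω' (Fin.castAdd k ⟨i, Nat.lt_succ_of_le hi⟩)
    simp only [Fin.append_left, boxEvent_lr] at this
    exact this
  · have := hω' (Fin.natAdd (k + 1) ⟨i, hi⟩)
    simp only [Fin.append_right, boxEvent_tb] at this
    exact this

/-- SIZES AND FLOORS OF THE FAMILY: every box of the ladder family is at least `h × h` (so at least `n × n` for
`n ≤ h`), and its annealed probability is at least any common floor `c` of the LR probabilities of the `2h × h`
boxes of the row and of the BT probabilities of its `h × h` squares. [folklore] -/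
theorem ladder_family (S : Set ℤ) (a b : ℤ) (h k n : ℕ) (hnh : n ≤ h) {c : ℝ}
    (hLR : ∀ a' : ℤ, c ≤ pLR S a' b (2 * h) h) (hTB : ∀ a' : ℤ, c ≤ pTB S a' b h h) :
    ∀ i, (n ≤ (Fin.append
        (fun i : Fin (k + 1) => (⟨true, a + (((i : ℕ) * h : ℕ) : ℤ), b, 2 * h, h⟩ : BoxSpec))
        (fun i : Fin k => (⟨false, a + (((i : ℕ) * h + h : ℕ) : ℤ), b, h, h⟩ : BoxSpec)) i).w ∧
      n ≤ (Fin.append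
        (fun i : Fin (k + 1) => (⟨true, a + (((i : ℕ) * h : ℕ) : ℤ), b, 2 * h, h⟩ : BoxSpec))
        (fun i : Fin k => (⟨false, a + (((i : ℕ) * h + h : ℕ) : ℤ), b, h, h⟩ : BoxSpec)) i).h) ∧
      c ≤ boxProb S (Fin.append
        (fun i : Fin (k + 1) => (⟨true, a + (((i : ℕ) * h : ℕ) : ℤ), b, 2 * h, h⟩ : BoxSpec))
        (fun i : Fin k => (⟨false, a + (((i : ℕ) * h + h : ℕ) : ℤ), b, h, h⟩ : BoxSpec)) i) := by
  intro i
  induction i using Fin.addCases with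
  | left i =>
    simp only [Fin.append_left, boxProb_lr]
    exact ⟨⟨by omega, hnh⟩, hLR _⟩
  | right i =>
    simp only [Fin.append_right, boxProb_tb]
    exact ⟨⟨hnh, hnh⟩, hTB _⟩

/-- A product of `K` reals each at least `c ≥ 0` is at least `c ^ K`. [folklore] -/
theorem pow_le_prod {K : ℕ} {c : ℝ} (f : Fin K → ℝ) (hc : 0 ≤ c) (hf : ∀ i, c ≤ f i) :
    c ^ K ≤ ∏ i, f i :=
  calc c ^ K = ∏ _i : Fin K, c := (Fin.prod_const K c).symm
    _ ≤ ∏ i, f i := Finset.prod_le_prod (fun _ _ => hc) (fun i _ => hf i)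

end LongCross

open LongCross in
/-- **STUB `stub_longCrossOfHarris`** (registered signature): `HorizontalClause → ApproxHarrisFam → LRAll` — long
left–right crossings for every column pattern and every aspect bound from the aspect-`2` horizontal clause and
approximate Harris for families of box events, by the ladder of `2h × h` boxes glued through BT crossings of the
`h × h` overlaps (ONE application of `ApproxHarrisFam` to `k + 1 + k` events at scale `h ≥ n ≥ n₀`) and the explicit
floor `bottomRowFloor` at the finitely many scales `n < n₀`. -/
theorem stub_longCrossOfHarris : LongCrossOfHarris := by
  intro hHor hFam k
  obtain ⟨cH, hcH, hHc⟩ := horizontalClause_iff.1 hHor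
  obtain ⟨cV, hcV, hVc⟩ := verticalClause_aspect 1
  obtain ⟨c, hc, hccH, hccV⟩ : ∃ c : ℝ, 0 < c ∧ c ≤ cH ∧ c ≤ cV :=
    ⟨min cH cV, lt_min hcH hcV, min_le_left _ _, min_le_right _ _⟩
  obtain ⟨n₀, hn₀⟩ := hFam (k + 1 + k) (c ^ (k + 1 + k) / 2) (by positivity)
  refine ⟨min (c ^ (k + 1 + k) / 2) ((1 / 2 : ℝ) ^ (k * n₀)), lt_min (by positivity) (by positivity), ?_⟩
  intro S n a b w h hn hnw hwk hnh _
  haveI := CouplingToLimits.isProbabilityMeasure_μIK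
  rw [nuMix_real_lrCross]
  have hw1 : 1 ≤ w := hn.trans hnw
  have hh1 : 1 ≤ h := hn.trans hnh
  rcases (Nat.lt_or_ge n n₀).symm with hn₀n | hlt
  · -- scales `n ≥ n₀`: the ladder and ONE application of approximate Harris
    have hfam := ladder_family S a b h k n hnh (c := c)
      (fun a' => hccH.trans (hHc S h hh1 a' b))
      (fun a' => hccV.trans (hVc S a' b h h hh1 hh1 (by omega)))
    have hHarris := hn₀ S n hn₀n _ (fun i => (hfam i).1)
    have hprod := pow_le_prod _ hc.le (fun i => (hfam i).2)
    have hsub := measureReal_mono (μ := μIK) (iInter_ladder_subset S a b hh1 k)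
    have hkh : k * n ≤ k * h := Nat.mul_le_mul_left k hnh
    have hmono : μIK.real (obs S ⁻¹' lrCross a b (k * h + 2 * h) h) ≤ pLR S a b w h :=
      stub_monotone.1 S a b w (k * h + 2 * h) h hw1 (by omega)
    calc min (c ^ (k + 1 + k) / 2) ((1 / 2 : ℝ) ^ (k * n₀)) ≤ c ^ (k + 1 + k) / 2 := min_le_left _ _
      _ ≤ pLR S a b w h := by linarith
  · -- scales `n < n₀`: the explicit floor of the all-black bottom row
    have hkn : k * n ≤ k * n₀ := Nat.mul_le_mul_left k hlt.le
    calc min (c ^ (k + 1 + k) / 2) ((1 / 2 : ℝ) ^ (k * n₀)) ≤ (1 / 2 : ℝ) ^ (k * n₀) := min_le_right _ _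
      _ ≤ (1 / 2 : ℝ) ^ w := pow_le_pow_of_le_one (by norm_num) (by norm_num) (hwk.trans hkn)
      _ ≤ pLR S a b w h := bottomRowFloor S a b w h hw1 hh1

end Summit.CriticalPhenomena.CardyFormulaZ2.Theorems.IKLinearTransport.PinnedDiagramExchange.QuenchedAssembly

end
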